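import Summits.QuantumFields.GaugeBoot.DiagonalRPTorusRestTerms
import Summits.QuantumFields.GaugeBoot.DiagonalRPTorusNegativeUnitary
import HarnessLib

/-!
# Inner-half diagonal RP fails on EVERY even three-torus `L ≥ 4` — `L = 4` included — for
`SU(N)` and `U(N)` at small coupling (gauge-boot, task L3 sequel `d = 3`, `L = 4`; 5/5, main file)

HONEST FRAMING (cell `pub-gaugeboot`, page 1 of every file): the venture produces certified bounds
on lattice expectations at stated coupling, gauge group, dimension and torus size; NOT a mass gap,
NOT a continuum limit, NOT a string tension; NOT Yang–Mills-summit-bearing (barriers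
`FixedCouplingUltralocality`, `PerturbativeInvisibility`). This module is a structural NEGATIVE
result about which positivity constraints a TORUS certificate may use; it discharges nothing else.

## Content

The tree's three-dimensional even-torus negative `DiagRPSUN.not_innerDiagonalRP_even_suN`
(L3(π)) needs `L ≥ 6`: in the plain cluster expansion of `⟨(ΘF)‾F⟩`, `F = P_X - P_Y`, the two
(negative) cross bands of order `β^{2L}` compete at `L = 4` with diagonal bands through the inner
half and through the mirror half. Here the same Polyakov pair `X = (c-1, 0)`, `Y = (-2, c-1)`
(`L = 2c`) is run through the HALF-ACTION TRICK (`DiagonalRPTorusHalfAction`,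
`DiagonalRPTorusPolyakovTrick`): the witness `F = (P_X - P_Y) · e^{-β halfSum}` cancels the
Boltzmann weights of the half and of its mirror image, the expansion runs over the REST plaquettes
only, and there (`DiagonalRPTorusRestShape`, no hypothesis `L ≥ 5`) the only clusters of order
`≤ 2L` joining a top-inner column to a mirror-side column are the two cross bands across the back
layer.

* `trickForm_le` — for `ρ z₀ = ω • 1` (`ω ≠ 1`), `0 ≤ β`, `2βN ≤ 1`, `L = 2c`, `c ≥ 2`:
  `trickForm ≤ -β^{2L} (J₁ + J₂) + C β^{2L+1}`, `J₁, J₂ > 0` the band integrals of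
  `DiagonalRPTorusBandTerm` / `DiagonalRPTorusBandValue`;
* **`not_innerDiagonalRP_even_three_of_moments`** — every compact metrisable `G`, continuous `ρ`
  (`N ≥ 1`) with a centre element and (R1), (R2) (`c₁, c₂ > 0`): for every EVEN `L ≥ 4` there is
  `β₀ > 0` with `¬ InnerDiagonalRP (d := 3) (L := L) ρ β 0 1` for all `0 < β ≤ β₀`;
* **`not_innerDiagonalRP_even_three_specialUnitary`** (`G ≅ SU(N)`, `N ≥ 2`),
  **`not_innerDiagonalRP_even_three_unitary`** (`G ≅ U(N)`, `N ≥ 1`), the concrete non-vacuous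
  **`not_innerDiagonalRP_even_three_suN`** / **`_uN`** (`Matrix.specialUnitaryGroup (Fin N) ℂ`,
  `Matrix.unitaryGroup (Fin N) ℂ`), and the back-gauge-invariant corollaries.

`β₀ = β₀(L, N)` is EXISTENTIAL (crude `2^{#rest}` tail), not uniform in `L`. MEANING (one
sentence): together with `DiagRPSUN.not_diagonalReflectionPositive_odd_suN/_uN` (odd `L ≥ 3`)
and the `d ≥ 4` files `DiagRPTube.*HighDim*`, the finite-torus transplants of diagonal RP (closed
half on odd tori, inner half on even tori) now fail as theorems for `SU(N)`, `U(N)` on EVERY torus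
`(ℤ/L)^d`, `d ≥ 3`, `L ≥ 3`, at small coupling — no finite case is left open. Elementary; printed
precedent for the phenomenon (spin systems, no proof): Fröhlich–Israel–Lieb–Simon, J. Stat. Phys.
22 (1980) 297, §3; Biskup, LNM 1970 (2009) §5.5.
-/

open MeasureTheory Finset Function
open scoped ComplexOrder

namespace Summit.QuantumFields.GaugeBoot

open Literature.MathematicalPhysics.QuantumFieldTheory
open Literature.MathematicalPhysics.QuantumFieldTheory.PlaquetteLowerBound (reTr)
open Literature.RepresentationTheory.CompactGroups

noncomputable section

namespace DiagRPRest

open DiagRPThree DiagRPPolyakov DiagRPSUN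
open DiagRPTube (restPlaqs trickForm cast_pred_ne_zero val_cast)

/-! ## Geometry of the witness on the even torus `L = 2c`, `c ≥ 2` -/

section Geometry

variable {L : ℕ} {c : ℕ}

/-- `2c = 0` in `ℤ/L`, `L = 2c`. -/
theorem two_mul_cast_c (hL : L = 2 * c) : 2 * ((c : ℕ) : ZMod L) = 0 := by
  have h : ((2 * c : ℕ) : ZMod L) = 0 := by rw [← hL]; exact ZMod.natCast_self L
  push_cast at h
  exact h

/-- `((c-1 : ℕ) : ℤ/L) = c - 1` (`c ≥ 1`). -/
theorem cast_pred_eq (hc : 2 ≤ c) : ((c - 1 : ℕ) : ZMod L) = (c : ZMod L) - 1 :=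
  Nat.cast_pred (by omega)

/-- `X = (c-1, 0)` lies on the top inner layer `δ = c - 1`. -/
theorem lay_colXe (hc : 2 ≤ c) :
    (colXe (L := L) c).1 - (colXe (L := L) c).2 = ((c - 1 : ℕ) : ZMod L) := by
  simp only [colXe, cast_pred_eq hc, sub_zero]

/-- `θX = (0, c-1)` lies on the layer `δ = -(c-1)`. -/
theorem lay_colXe_swap (hc : 2 ≤ c) :
    (colXe (L := L) c).swap.1 - (colXe (L := L) c).swap.2 = -((c - 1 : ℕ) : ZMod L) := by
  simp only [colXe, Prod.fst_swap, Prod.snd_swap, cast_pred_eq hc, zero_sub]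

/-- `Y = (-2, c-1)` lies on the top inner layer `δ = c - 1` (`L = 2c`). -/
theorem lay_colYe (hc : 2 ≤ c) (hL : L = 2 * c) :
    (colYe (L := L) c).1 - (colYe (L := L) c).2 = ((c - 1 : ℕ) : ZMod L) := by
  simp only [colYe, cast_pred_eq hc]
  linear_combination -(two_mul_cast_c hL)

/-- `θY = (c-1, -2)` lies on the layer `δ = -(c-1)` (`L = 2c`). -/
theorem lay_colYe_swap (hc : 2 ≤ c) (hL : L = 2 * c) :
    (colYe (L := L) c).swap.1 - (colYe (L := L) c).swap.2 = -((c - 1 : ℕ) : ZMod L) := by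
  simp only [colYe, Prod.fst_swap, Prod.snd_swap, cast_pred_eq hc]
  linear_combination two_mul_cast_c hL

/-- `θX = Y + 2e₀`. -/
theorem colXe_swap_eq (c : ℕ) : (colXe (L := L) c).swap = bump 0 (bump 0 (colYe (L := L) c)) :=
  (bump_bump_colYe c).symm

/-- `X = θY + 2e₁`. -/
theorem colXe_eq (c : ℕ) : colXe (L := L) c = bump 1 (bump 1 (colYe (L := L) c).swap) :=
  (bump_bump_colYe_swap c).symm

/-- **The diagonal pair `(θX, X)` has none of the three offsets** (`L = 2c`, `c ≥ 2`). -/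
theorem offsets_colXe [NeZero L] (hc : 2 ≤ c) (hL : L = 2 * c) :
    (colXe (L := L) c).swap ≠ bump 0 (bump 0 (colXe c)) ∧
      colXe (L := L) c ≠ bump 1 (bump 1 (colXe c).swap) ∧
        bump 1 (colXe (L := L) c).swap ≠ bump 0 (colXe c) := by
  have h1 : (c : ZMod L) - 1 ≠ 0 := by rw [← cast_pred_eq hc]; exact cast_pred_ne_zero hc hL
  have h0 : (c : ZMod L) ≠ 0 := natCast_ne_zero_of_lt (L := L) (by omega) (by omega)
  simp only [colXe, Prod.swap_prod_mk, bump_zero, bump_one, ne_eq, Prod.mk.injEq, not_and]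
  exact ⟨fun _ h => h1 h, fun h => absurd h h1, fun h => absurd (by linear_combination -h) h0⟩

/-- **The diagonal pair `(θY, Y)` has none of the three offsets** (`L = 2c`, `c ≥ 2`). -/
theorem offsets_colYe [NeZero L] (hc : 2 ≤ c) (hL : L = 2 * c) :
    (colYe (L := L) c).swap ≠ bump 0 (bump 0 (colYe c)) ∧
      colYe (L := L) c ≠ bump 1 (bump 1 (colYe c).swap) ∧
        bump 1 (colYe (L := L) c).swap ≠ bump 0 (colYe c) := by
  have h1 : (c : ZMod L) - 1 ≠ 0 := by rw [← cast_pred_eq hc]; exact cast_pred_ne_zero hc hL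
  have h0 : (c : ZMod L) ≠ 0 := natCast_ne_zero_of_lt (L := L) (by omega) (by omega)
  have h2 : (c : ZMod L) + 1 ≠ 0 := by
    have h := natCast_ne_zero_of_lt (L := L) (k := c + 1) (by omega) (by omega)
    push_cast at h
    exact h
  simp only [colYe, Prod.swap_prod_mk, bump_zero, bump_one, ne_eq, Prod.mk.injEq, not_and]
  refine ⟨fun h => absurd (by linear_combination h) h1, fun h => absurd (by linear_combination -h) h2,
    fun h => absurd (by linear_combination h) h0⟩

end Geometry

/-! ## The trick form is dominated by the two cross bands -/

section Estimate

variable {L : ℕ} [NeZero L] {N : ℕ} {G : Type*} [Group G] [TopologicalSpace G]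
  [IsTopologicalGroup G] [CompactSpace G] [MeasurableSpace G] [BorelSpace G]
  [SecondCountableTopology G] (ρ : G →* Matrix (Fin N) (Fin N) ℂ)

/-- ★ **The trick form is dominated by the two cross bands.** On the even torus `L = 2c`,
`c ≥ 2`, with `X = (c-1, 0)`, `Y = (-2, c-1)`: for `ρ z₀ = ω • 1`, `ω ≠ 1`, `0 ≤ β`, `2βN ≤ 1`,
`trickForm(P_X - P_Y) ≤ -β^{2L} (J₁ + J₂) + C β^{2L+1}`, `J₁, J₂` the band integrals of the
cross pairs, `C = 4·2^R N² (2N)^{2L+1} + 2 N² 2^{2L} N^{2L+1}`, `R` the number of rest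
plaquettes. -/
theorem trickForm_le (hρ : Continuous ρ) {z₀ : G} {ω : ℂ}
    (hz₀ : ρ z₀ = ω • (1 : Matrix (Fin N) (Fin N) ℂ)) (hω : ω ≠ 1) {c : ℕ} (hc : 2 ≤ c)
    (hL : L = 2 * c) {β : ℝ} (hβ : 0 ≤ β) (hγ : 2 * β * N ≤ 1) :
    trickForm ρ (0 : Fin 3) 1 c β
        (fun U : GaugeConfig 3 L G =>
          polRe ρ 2 U (vsite (colXe (L := L) c) 0) - polRe ρ 2 U (vsite (colYe (L := L) c) 0)) ≤
      -(β ^ (2 * L) * (bandIntegral ρ plane02 (colYe (L := L) c) +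
          bandIntegral ρ plane12 (colYe (L := L) c).swap)) +
        β ^ (2 * L + 1) * (4 * 2 ^ (restPlaqs (L := L) (0 : Fin 3) 1 c).card * N ^ 2 *
            (2 * N) ^ (2 * L + 1) + 2 * N ^ 2 * 2 ^ (2 * L) * N ^ (2 * L + 1)) := by
  set R : ℕ := (restPlaqs (L := L) (0 : Fin 3) 1 c).card with hR
  obtain ⟨a1, a2, a3⟩ := offsets_colXe (L := L) hc hL
  obtain ⟨d1, d2, d3⟩ := offsets_colYe (L := L) hc hL
  have ha := abs_sum_rest_le_of_offsets ρ β hρ hz₀ hω hβ hγ hc hL (lay_colXe hc)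
    (lay_colXe_swap hc) a1 a2 a3
  have hd := abs_sum_rest_le_of_offsets ρ β hρ hz₀ hω hβ hγ hc hL (lay_colYe hc hL)
    (lay_colYe_swap hc hL) d1 d2 d3
  have hb := sum_rest_ge_band02 ρ β hρ hz₀ hω hβ hγ hc hL (lay_colYe hc hL) (lay_colXe_swap hc)
    (colXe_swap_eq c)
  have hc' := sum_rest_ge_band12 ρ β hρ hz₀ hω hβ hγ hc hL (lay_colXe hc) (lay_colYe_swap hc hL)
    (colXe_eq c)
  rw [trickForm_polDiff_eq_sum ρ β hρ c]
  simp only [sum_add_distrib, sum_sub_distrib]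
  rw [abs_le] at ha hd
  have hγpow : (2 * β * N) ^ (2 * L + 1) = β ^ (2 * L + 1) * (2 * N) ^ (2 * L + 1) := by
    rw [show 2 * β * (N : ℝ) = β * (2 * N) by ring, mul_pow]
  have hβNpow : (β * N) ^ (2 * L + 1) = β ^ (2 * L + 1) * N ^ (2 * L + 1) := mul_pow _ _ _
  have hDE : 4 * (2 ^ R * (N ^ 2 * (2 * β * N) ^ (2 * L + 1))) +
      2 * (N ^ 2 * (2 ^ (2 * L) * (β * N) ^ (2 * L + 1))) =
      β ^ (2 * L + 1) * (4 * 2 ^ R * N ^ 2 * (2 * N) ^ (2 * L + 1) +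
        2 * N ^ 2 * 2 ^ (2 * L) * N ^ (2 * L + 1)) := by
    rw [hγpow, hβNpow]; ring
  linarith [ha.2, hd.2, hb, hc']

/-- ★★ **Inner-half diagonal RP fails on every even three-torus `L ≥ 4` at small coupling, from
the character moments.** Let `G` be a compact metrisable group, `ρ` continuous with `N ≥ 1`, with a
centre element `ρ z₀ = ω • 1`, `ω ≠ 1`, and with the character identities
(R1) `∫ Re χ(x g⁻¹) Re χ(g y) dg = c₁ Re χ(x y)`, (R2) `∫ Re χ(g x g⁻¹ y) dg = c₂ Re(χ(x) χ(y))`,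
`c₁, c₂ > 0`. Then for every even `L ≥ 4` there is `β₀ > 0` such that
`¬ InnerDiagonalRP (d := 3) (L := L) ρ β 0 1` for all `0 < β ≤ β₀`. -/
theorem not_innerDiagonalRP_even_three_of_moments (hLeven : Even L) (h4 : 4 ≤ L)
    (hρ : Continuous ρ) (hN : 1 ≤ N) {z₀ : G} {ω : ℂ}
    (hz₀ : ρ z₀ = ω • (1 : Matrix (Fin N) (Fin N) ℂ)) (hω : ω ≠ 1) {c₁ c₂ : ℝ} (hc₁ : 0 < c₁)
    (hc₂ : 0 < c₂)
    (hR1 : ∀ x y : G, ∫ g, reTr ρ (x * g⁻¹) * reTr ρ (g * y) ∂haarProbability G =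
      c₁ * reTr ρ (x * y))
    (hR2 : ∀ x y : G, ∫ g, reTr ρ (g * x * g⁻¹ * y) ∂haarProbability G =
      c₂ * ((ρ x).trace * (ρ y).trace).re) :
    ∃ β₀ : ℝ, 0 < β₀ ∧ ∀ β : ℝ, 0 < β → β ≤ β₀ →
      ¬ InnerDiagonalRP (d := 3) (L := L) ρ β 0 1 := by
  obtain ⟨c, hc⟩ := hLeven
  have hL : L = 2 * c := by omega
  have hc2 : 2 ≤ c := by omega
  have hL3 : 3 ≤ L := by omega
  have hLc : L / 2 = c := by omega
  set I₁ := bandIntegral ρ plane02 (colYe (L := L) c) with hI₁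
  set I₂ := bandIntegral ρ plane12 (colYe (L := L) c).swap with hI₂
  have hI₁pos : 0 < I₁ := bandIntegral_pos ρ plane02 _ hρ hL3 rfl hN hc₁ hc₂ hR1 hR2
  have hI₂pos : 0 < I₂ := bandIntegral_pos ρ plane12 _ hρ hL3 rfl hN hc₁ hc₂ hR1 hR2
  set C : ℝ := 4 * 2 ^ (restPlaqs (L := L) (0 : Fin 3) 1 c).card * N ^ 2 * (2 * N) ^ (2 * L + 1) +
    2 * N ^ 2 * 2 ^ (2 * L) * N ^ (2 * L + 1) with hC
  have hNpos : (0 : ℝ) < N := by exact_mod_cast hN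
  have hCpos : 0 < C := by positivity
  refine ⟨min (1 / (2 * N)) ((I₁ + I₂) / (2 * C)), lt_min (by positivity) (by positivity),
    fun β hβ hβ0 => ?_⟩
  have hγ : 2 * β * N ≤ 1 := by
    have h := (le_min_iff.1 hβ0).1
    rw [le_div_iff₀ (by positivity)] at h
    linarith
  have hβC : β * C < I₁ + I₂ := by
    have h := (le_min_iff.1 hβ0).2
    rw [le_div_iff₀ (by positivity)] at h
    linarith
  -- the trick form is negative
  have hneg : trickForm ρ (0 : Fin 3) 1 c β (fun U : GaugeConfig 3 L G =>
      polRe ρ 2 U (vsite (colXe (L := L) c) 0) - polRe ρ 2 U (vsite (colYe (L := L) c) 0)) < 0 := by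
    have h := trickForm_le ρ hρ hz₀ hω hc2 hL hβ.le hγ
    have hpow : 0 < β ^ (2 * L) := pow_pos hβ _
    have : -(β ^ (2 * L) * (I₁ + I₂)) + β ^ (2 * L + 1) * C =
        -(β ^ (2 * L) * ((I₁ + I₂) - β * C)) := by ring
    rw [← hI₁, ← hI₂, ← hC, this] at h
    nlinarith [mul_pos hpow (sub_pos.2 hβC)]
  -- hence the witness `(P_X - P_Y) e^{-β halfSum}` refutes inner-half diagonal RP
  refine DiagRPTube.not_innerDiagonalRP_of_trickForm_neg ρ hρ (continuous_polDiff ρ hρ _ _)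
    (isInnerHalfObservable_polDiff ρ ?_ ?_) (by rw [hLc]; exact hneg)
  · rw [lay_colXe hc2, val_cast (by omega)]; omega
  · rw [lay_colYe hc2 hL, val_cast (by omega)]; omega

/-- ★★ **Inner-half diagonal RP fails on EVERY even three-torus `L ≥ 4` for `G ≅ SU(N)` at
small coupling** (`IsSpecialUnitaryModel ρ`, `N ≥ 2`; `β₀ = β₀(L, N)`): the `L = 4` case left
open by `DiagRPSUN.not_innerDiagonalRP_even_specialUnitary` (`L ≥ 6`) is included. -/
theorem not_innerDiagonalRP_even_three_specialUnitary (hρ : IsSpecialUnitaryModel ρ) (hN : 2 ≤ N)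
    (hLeven : Even L) (h4 : 4 ≤ L) :
    ∃ β₀ : ℝ, 0 < β₀ ∧ ∀ β : ℝ, 0 < β → β ≤ β₀ →
      ¬ InnerDiagonalRP (d := 3) (L := L) ρ β 0 1 := by
  obtain ⟨z₀, ω, hω, hz₀⟩ := exists_smul_one ρ hρ hN
  obtain ⟨c₁, hc₁, hR1⟩ := exists_re_conv_const ρ hρ hN
  have hNpos : (0 : ℝ) < N := by exact_mod_cast (show 0 < N by omega)
  exact not_innerDiagonalRP_even_three_of_moments ρ hLeven h4 hρ.1 (by omega) hz₀ hω hc₁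
    (inv_pos.2 hNpos) hR1 (integral_re_trace_conj_mul ρ hρ)

/-- The back-gauge-invariant closed-half statement fails as well for `G ≅ SU(N)` (it implies the
inner-half one), every even `L ≥ 4`. -/
theorem not_backInvariantDiagonalRP_even_three_specialUnitary (hρ : IsSpecialUnitaryModel ρ)
    (hN : 2 ≤ N) (hLeven : Even L) (h4 : 4 ≤ L) :
    ∃ β₀ : ℝ, 0 < β₀ ∧ ∀ β : ℝ, 0 < β → β ≤ β₀ →
      ¬ BackInvariantDiagonalRP (d := 3) (L := L) ρ β 0 1 := by
  obtain ⟨β₀, hβ₀, h⟩ := not_innerDiagonalRP_even_three_specialUnitary ρ hρ hN hLeven h4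
  exact ⟨β₀, hβ₀, fun β hβ hβ1 hB => h β hβ hβ1 hB.innerDiagonalRP⟩

/-- ★★ **Inner-half diagonal RP fails on EVERY even three-torus `L ≥ 4` for `G ≅ U(N)` at
small coupling** (`IsUnitaryModel ρ`, `N ≥ 1`; `β₀ = β₀(L, N)`). -/
theorem not_innerDiagonalRP_even_three_unitary (hρ : IsUnitaryModel ρ) (hN : 1 ≤ N)
    (hLeven : Even L) (h4 : 4 ≤ L) :
    ∃ β₀ : ℝ, 0 < β₀ ∧ ∀ β : ℝ, 0 < β → β ≤ β₀ →
      ¬ InnerDiagonalRP (d := 3) (L := L) ρ β 0 1 := by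
  obtain ⟨z₀, ω, hω, hz₀⟩ := exists_smul_one_unitary ρ hρ
  have hNpos : (0 : ℝ) < N := by exact_mod_cast hN
  exact not_innerDiagonalRP_even_three_of_moments ρ hLeven h4 hρ.1 hN hz₀ hω
    (c₁ := (2 * N : ℝ)⁻¹) (by positivity) (inv_pos.2 hNpos)
    (integral_re_trace_mul_inv_mul_unitary ρ hρ) (integral_re_trace_conj_mul_unitary ρ hρ)

/-- The back-gauge-invariant closed-half statement fails as well for `G ≅ U(N)`, every even
`L ≥ 4`. -/
theorem not_backInvariantDiagonalRP_even_three_unitary (hρ : IsUnitaryModel ρ) (hN : 1 ≤ N)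
    (hLeven : Even L) (h4 : 4 ≤ L) :
    ∃ β₀ : ℝ, 0 < β₀ ∧ ∀ β : ℝ, 0 < β → β ≤ β₀ →
      ¬ BackInvariantDiagonalRP (d := 3) (L := L) ρ β 0 1 := by
  obtain ⟨β₀, hβ₀, h⟩ := not_innerDiagonalRP_even_three_unitary ρ hρ hN hLeven h4
  exact ⟨β₀, hβ₀, fun β hβ hβ1 hB => h β hβ hβ1 hB.innerDiagonalRP⟩

end Estimate

/-! ## The concrete groups `SU(N)`, `U(N)` -/

section Groups

open Literature.MathematicalPhysics.QuantumLattice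

/-- ★★ **`SU(N)` lattice gauge theory (`N ≥ 2`: `SU(2)`, `SU(3)`, …) violates inner-half
diagonal RP on every even three-torus `(ℤ/L)³`, `L ≥ 4` — so on `(ℤ/4)³` — for all sufficiently
small `β > 0`** (not vacuous: the defining representation of `Matrix.specialUnitaryGroup`). -/
theorem not_innerDiagonalRP_even_three_suN {L N : ℕ} [NeZero L] (hN : 2 ≤ N) (hLeven : Even L)
    (h4 : 4 ≤ L) :
    ∃ β₀ : ℝ, 0 < β₀ ∧ ∀ β : ℝ, 0 < β → β ≤ β₀ →
      ¬ InnerDiagonalRP (d := 3) (L := L) (fundamentalRep (Fin N)) β 0 1 := by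
  haveI : SecondCountableTopology (Matrix (Fin N) (Fin N) ℂ) :=
    inferInstanceAs (SecondCountableTopology (Fin N → Fin N → ℂ))
  haveI : SecondCountableTopology (Matrix.specialUnitaryGroup (Fin N) ℂ) :=
    Topology.IsEmbedding.subtypeVal.secondCountableTopology
  exact not_innerDiagonalRP_even_three_specialUnitary (fundamentalRep (Fin N))
    (TorusAreaLaw.isSpecialUnitaryModel_fundamentalRep N) hN hLeven h4

/-- **`SU(N)` violates the back-gauge-invariant closed-half diagonal RP on every even three-torus
`L ≥ 4` at small coupling.** -/
theorem not_backInvariantDiagonalRP_even_three_suN {L N : ℕ} [NeZero L] (hN : 2 ≤ N)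
    (hLeven : Even L) (h4 : 4 ≤ L) :
    ∃ β₀ : ℝ, 0 < β₀ ∧ ∀ β : ℝ, 0 < β → β ≤ β₀ →
      ¬ BackInvariantDiagonalRP (d := 3) (L := L) (fundamentalRep (Fin N)) β 0 1 := by
  obtain ⟨β₀, hβ₀, h⟩ := not_innerDiagonalRP_even_three_suN (L := L) hN hLeven h4
  exact ⟨β₀, hβ₀, fun β hβ hβ1 hB => h β hβ hβ1 hB.innerDiagonalRP⟩

/-- ★★ **`U(N)` lattice gauge theory (`N ≥ 1`; `N = 1`: compact `U(1)`) violates inner-half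
diagonal RP on every even three-torus `(ℤ/L)³`, `L ≥ 4`, for all sufficiently small `β > 0`**
(not vacuous). -/
theorem not_innerDiagonalRP_even_three_uN {L N : ℕ} [NeZero L] (hN : 1 ≤ N) (hLeven : Even L)
    (h4 : 4 ≤ L) :
    ∃ β₀ : ℝ, 0 < β₀ ∧ ∀ β : ℝ, 0 < β → β ≤ β₀ →
      ¬ InnerDiagonalRP (d := 3) (L := L) (unitaryFundamentalRep (Fin N) ℂ) β 0 1 := by
  haveI : SecondCountableTopology (Matrix.unitaryGroup (Fin N) ℂ) :=
    IsUnitaryModel.secondCountableTopology _ (isUnitaryModel_unitaryFundamentalRep N)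
  exact not_innerDiagonalRP_even_three_unitary (unitaryFundamentalRep (Fin N) ℂ)
    (isUnitaryModel_unitaryFundamentalRep N) hN hLeven h4

/-- **`U(N)` violates the back-gauge-invariant closed-half diagonal RP on every even three-torus
`L ≥ 4` at small coupling.** -/
theorem not_backInvariantDiagonalRP_even_three_uN {L N : ℕ} [NeZero L] (hN : 1 ≤ N)
    (hLeven : Even L) (h4 : 4 ≤ L) :
    ∃ β₀ : ℝ, 0 < β₀ ∧ ∀ β : ℝ, 0 < β → β ≤ β₀ →
      ¬ BackInvariantDiagonalRP (d := 3) (L := L) (unitaryFundamentalRep (Fin N) ℂ) β 0 1 := by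
  obtain ⟨β₀, hβ₀, h⟩ := not_innerDiagonalRP_even_three_uN (L := L) hN hLeven h4
  exact ⟨β₀, hβ₀, fun β hβ hβ1 hB => h β hβ hβ1 hB.innerDiagonalRP⟩

end Groups

end DiagRPRest

end

end Summit.QuantumFields.GaugeBoot
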